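import Summits.BirchSwinnertonDyer.BirchSwinnertonDyer.Theorems.RamifiedHeegnerPairLeafHabitatSocket
import Literature.NumberTheory.EllipticCurves.WZhang2014.LevelRaisedBipartiteSystem
import Literature.NumberTheory.EllipticCurves.Kato2004.Condition1252
import HarnessLib

-- the cell's Cruxes namespace repeats the summit name (Summit.<Summit>.<Problem>), as in every sibling file
set_option linter.dupNamespace false
set_option autoImplicit false

noncomputable section

open scoped Classical NumberField

/-!
# Line `definitesum` for crux U₁ = `RamifiedHeegnerPair.LeafRankOneUpperAtThree` (stmt-BirchSwinnertonDyer-26022):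
# «the DEFINITE side sees the Tamagawa SUM» — Kato's rank-ZERO, Tamagawa-exact upper halves for the LEVEL-RAISED
# congruent definite eigensystems at deep Kolyvagin primes, fed into a deep bipartite (Bertolini–Darmon ∕ Howard)
# rigidity over the Heegner field, bound `ord₃ #Ш(E/K)[3^∞] ≤ 2·(ord₃[E(K):ℤy_K] − ord₃ ∏ c_ℓ)` — BSD-sharp.

Crux-ideate seat 1 (`cruxidea-stmt-BirchSwinnertonDyer-26022-1`, round 1, gen 2), lens SIDE-SWITCH ∕ duality; card `Lines/definitesum.md`,
idea `Ideas/definitesum.md`. Nothing is asserted: `sorry` occurs ONLY inside the six `stub_*`; the composition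
`LeafRankOneUpperAtThree_of` ∕ `LeafRankOneUpperAtThree_of_stubs` is kernel-checked and concludes the crux BY NAME through the habitat socket
(`LeafShimuraInert.leafRankOneUpperAtThree_of_habitatRoad_of_sigmaStarTopLayerOffHabitat_of_lowerRankZero`, p764474) at the habitat
`HabDs W := Kato2004.ImageContainsSL2 W 3` (Kato's (12.5.2) at `p = 3`; the same row predicate as line `katoprhalf`). U₁ stays OPEN; BSD is
proved for no curve; every display below is CONDITIONAL on the stubs it names.

## The mechanism in one paragraph

Jetchev's improvement of Kolyvagin's bound reads ONE component group and saves `max_ℓ ord₃ c_ℓ`; BSD wants the SUM `T := ord₃ ∏_ℓ c_ℓ`.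
The sum is a rank-ZERO quantity: it is the Tamagawa term of the Euler characteristic in Kato's bound `#Sel ≤ |L(1)/Ω| / Tam` — printed,
Tamagawa-exact, at an odd ADDITIVE potentially good prime under (12.5.2) (Kato 2004 Thm. 14.5 (3) with the Poitou–Tate count; the route's own
rank-zero item U₀ `LeafRankZeroUpperAtThree` is settled on the onto rows this way). The rank-one curve `E` never offers a central VALUE to
Kato — but the congruent DEFINITE eigensystems do: raise the level of `f_E` modulo `3^k` at an odd set `m` of deep Kolyvagin primes
(`q` inert in `K`, `3^k ∣ q+1`, `3^k ∣ a_q`; level raising holds for either sign, `n_± = ord₃(q+1∓a_q) ≥ k`, Bertolini–Darmon 1999 §5),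
on the definite quaternion algebra ramified at `m ∪ {∞}`; the value `λ_k(m) ∈ ℤ/3^k` of the raised eigensystem on the oriented Gross vector
of `K` is (Gross's formula, Ribet–Takahashi ∕ Pollack–Weston period ratio) the square root of `L_alg(g_m/K,1)` in the normalisation in which
the raised primes' Tamagawa factors cancel and the CARRIERS' factors `∏_{ℓ∣N} c_ℓ(A_{g_m})² ` (every `ℓ ∣ N` splits in `K`) survive; for a deep
congruence `c_ℓ(A_{g_m})[3^∞] ⊇ c_ℓ(E)[3^∞]` (the `3`-part of an additive component group is `H⁰(ℚ_ℓ, E[3^∞])`, a function of the torsion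
GALOIS MODULE). Kato for `g_m` and `g_m ⊗ χ_K` then gives `ord₃ λ_k(m) ≥ min(k, T)` at EVERY odd deep level (stub SYSTEM, Kato half).
The classes `κ_k(m) ∈ H¹(K, E[3^k])` at even deep levels (Heegner points on the Shimura curves `X_{N; m}`) and the values at odd levels
form a deep BIPARTITE system tied by the two reciprocity laws in DEPTH currency (`3^s ∣ λ_k(m ∪ q) ⟺ loc_q κ_k(m) ∈ 3^s·H¹_fin`, Jochnowitz
∕ Bertolini–Darmon first and second laws, read on the `±`-eigenlines of `τ = Frob_q` of the rank-four module `H¹(K_q, E[3^k])` — the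
Kolyvagin-prime replacement of admissible primes, which do not exist at `p = 3`) (stub SYSTEM, geometric half). Howard's rigidity for
bipartite systems over `ℤ/3^k` (Thm. 3.2.3 shape: `Sel ≅ R ⊕ M ⊕ M`, and the divisibility index `e` of the system is level-independent with
`ind κ(∅) = e + length M`) then turns «every odd value is divisible by `3^T`» into `e ≥ T`, i.e. `length M ≤ m₀ − T` with
`3^{m₀} ∥ [E(K) ⊗ ℤ₃ : ℤ₃ y_K]`: the display `ord₃ #Ш(E/K)[3^∞] + 2T ≤ 2·ord₃ [E(K):ℤy_K]` (stub RIGIDITY), BSD-sharp for the pair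
`(E, E^K)`. The kernel (stub KERNEL, bookkeeping) reads U₁ for `E` off the display with Gross–Zagier, the print of item 27491 and the
rank-zero LOWER half `L₀` (item 26023) for the leaf partner `E^K` (`3` splits in `K`), exactly as the v15 ∕ nscartan kernels do.

## Registered stubs (2 RESEARCH, 1 BOOKKEEPING, 3 PRINT ∕ BY-NAME residue)

* `stub_printFacts` — PRINT: item 27491 `LeafRankOnePrintedInputsAtThree` and the six cite-only facts the socket consumes, BY NAME.
* `stub_divisibleDeepBipartiteSystemAtThree` — RESEARCH XL (THE NEW LEVER): existence, on every habitat row and Heegner datum, of the deep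
  bipartite datum mod `3^k` with realisation, sign, Selmer conditions, the two depth-currency laws AND Kato divisibility of every odd value.
* `stub_deepBipartiteRigidityAtThree` — RESEARCH L: Howard ∕ Bertolini–Darmon rigidity at Kolyvagin primes for `p = 3` ⟹ the display.
* `stub_definiteShadowKernelAtThree` — BOOKKEEPING M: display + print + `L₀` ⟹ ROAD(`HabDs`).
* `stub_leafSigmaStarTopLayerOffDefiniteHabitat` — RESIDUE: Σ★⁸ (v15's registered signature) on the rows with `¬ HabDs W` only; item 27493
  ⟹ it by name (`LeafShimuraInert.sigmaStarTopLayerOffHabitat_of_leafSigmaStarOptOffRows HabDs`).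
* `stub_gss2LowerAtThreeRankZero` — item 26023 `Gss2LowerAtThreeRankZero` BY NAME (a binder of the route's `closes` anyway).

[cite: Kato2004, Thm. 14.5 (3), Thm. 12.5 (4), §14.16] [cite: BertoliniDarmon2005, Thm. 4.1, Thm. 4.2] [cite: Howard2006, Thm. 3.2.3]
[cite: BertoliniDarmon1999, Thm. 1.3, §5] [cite: WZhang2014, Thm. 4.3, §8.1] [cite: RibetTakahashi1997, Thm. 1] [cite: PollackWeston2011, Thm. 1.1, §6]
[cite: Jetchev2008, Thm. 1.1, Conj. 1.3] [cite: GrossLMS1991, Prop. 3.7, §6] [cite: GrossZagier1986, Thm. I.(6.3)]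
-/

namespace Summit.BirchSwinnertonDyer.BirchSwinnertonDyer.Cruxes.LeafRankOneUpperAtThree.Definitesum

open WeierstrassCurve NumberField IsDedekindDomain IsDedekindDomain.HeightOneSpectrum Literature
  Literature.NumberTheory.EllipticCurves
  Rat.HeightOneSpectrum CongruenceSubgroup
  Literature.NumberTheory.EllipticCurves.ModularForms
  Literature.NumberTheory.EllipticCurves.Rank1Residual
  Literature.NumberTheory.EllipticCurves.Rank1Residual.Typed
  Literature.NumberTheory.EllipticCurves.KrizLi2019
  Literature.NumberTheory.QuadraticFields
  Literature.NumberTheory.QuadraticFields.Quadratic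
  Literature.NumberTheory.GaloisCohomology
  Literature.NumberTheory.GaloisRepresentations
  Literature.NumberTheory.Automorphic
  Summit.BirchSwinnertonDyer.Rank1Residual
  Summit.BirchSwinnertonDyer.Rank1Residual.Additive
  Summit.BirchSwinnertonDyer.Rank1Residual.X11b
  Summit.BirchSwinnertonDyer.Rank1Residual.X11b.Three
  Summit.BirchSwinnertonDyer.BirchSwinnertonDyer.Theses.RamifiedHeegnerPair
  Summit.BirchSwinnertonDyer.BirchSwinnertonDyer.Theorems

/-! ## The habitat and the deep Kolyvagin primes -/

/-- **The definite-shadow habitat `HabDs`**: Kato's condition (12.5.2) at `p = 3` — the `3`-adic image of `W` contains `SL₂(ℤ₃)` (tree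
`Kato2004.ImageContainsSL2 W 3`; it implies `ρ̄_{W,3}` onto `GL₂(𝔽₃)`, hence `E(K)[3] = 0` and the Čebotarev supply of Kolyvagin primes of every
depth). The same row predicate as line `katoprhalf`; a bare predicate, as the habitat socket wants. [cite: Kato2004, (12.5.2), Thm. 14.5] -/
def HabDs : WeierstrassCurve ℚ → Prop := fun W ↦ Kato2004.ImageContainsSL2 W 3

/-- A **deep Kolyvagin prime of depth `≥ k` at `p = 3`** for `(W, K)` at conductor `N`: a Kolyvagin prime in W. Zhang's sense (prime, `ℓ ∤ N`,
`ℓ ∤ d_K`, `ℓ ≠ 3`, inert in `K`, positive Kolyvagin index) whose Kolyvagin index `M(ℓ) = ord₃ gcd(ℓ+1, a_ℓ)` is at least `k`, so that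
`E[3^k]` is a trivial `G_{K_ℓ}`-module, `H¹(K_ℓ, E[3^k]) ≅ (ℤ/3^k)⁴ = fin ⊕ sing`, and `Frob_ℓ = τ` splits each half into rank-one `±`-lines.
Level raising of `f_E mod 3^k` at such `ℓ` holds for either sign since `ord₃(ℓ+1 ∓ a_ℓ) ≥ k` (Bertolini–Darmon 1999 §5; Diamond–Taylor).
Over existing vocabulary only. [cite: WZhang2014, Notations (xii)] [cite: BertoliniDarmon1999, §5] -/
def IsDeepKolyvaginPrime (N : ℕ) (W : WeierstrassCurve ℚ) [W.IsGloballyMinimal] (K : Type) [Field K] [NumberField K] (k ℓ : ℕ) : Prop :=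
  Zhang2014.IsKolyvaginPrime N W K 3 ℓ ∧ k ≤ Zhang2014.kolyvaginIndex W 3 ℓ

/-- A **deep level**: a finite set of deep Kolyvagin primes of depth `≥ k` (even cardinality: indefinite side, classes; odd: definite side,
values). [cite: BertoliniDarmon2005, §2.2] [cite: Howard2006, §2.3] -/
def IsDeepLevel (N : ℕ) (W : WeierstrassCurve ℚ) [W.IsGloballyMinimal] (K : Type) [Field K] [NumberField K] (k : ℕ) (m : Finset ℕ) : Prop :=
  ∀ ℓ ∈ m, IsDeepKolyvaginPrime N W K k ℓ

/-! ## The deep bipartite datum mod `3^k` and its printed-shape properties (W. Zhang's typed template at torsion level `3^k`,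
Kolyvagin conductors suppressed: `n = 1` throughout) -/

/-- **Deep bipartite DATA mod `3^k`** for `E = W` over `K`: signs `ε(m)` and classes `κ_k(m) ∈ H¹(K, E[3^k])` at even deep levels `m`
(Kummer images of Heegner points on the Shimura curves `X_{N;m}`, `κ_k(∅)` = Kolyvagin's class of `y_K`), values `λ_k(m′) ∈ ℤ/3^k` at odd
deep levels `m′` (the raised eigensystem `𝕋 → ℤ/3^k` of the definite algebra `B_{m′∞}`, Eichler level `N`, on the oriented Gross vector of
`K`). Pure data; values at non-deep levels are junk; the properties are the predicates below. Template:
`WZhang2014.LevelRaisedBipartiteData` (torsion level `p`, admissible primes, `p ≥ 5`, `p ∤ N`) — here `p = 3`, `9 ∣ N`, Kolyvagin primes.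
[cite: WZhang2014, §3.9 (3.30), Thm. 4.3] [cite: BertoliniDarmon2005, §2] -/
structure DeepBipartiteData (W : WeierstrassCurve ℚ) (K : Type) [Field K] [NumberField K] (k : ℕ) where
  /-- `m ↦ ε(m) ∈ {±1}`: complex conjugation acts on `κ_k(m)` by `ε(m)`. -/
  sign : Finset ℕ → ℤ
  /-- `m ↦ κ_k(m) ∈ H¹(K, E[3^k])` at even deep levels. -/
  cls : Finset ℕ → galH1Torsion (W.baseChange K) ((3 ^ k : ℕ) : ℤ)
  /-- `m′ ↦ λ_k(m′) ∈ ℤ/3^k` at odd deep levels. -/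
  val : Finset ℕ → ZMod (3 ^ k)

namespace DeepBipartiteData

variable {W : WeierstrassCurve ℚ} [W.IsGloballyMinimal] {K : Type} [Field K] [NumberField K] {k : ℕ} {N : ℕ} [NeZero N]

/-- **REALISATION**: the bottom class `κ_k(∅)` is Kolyvagin's class mod `3^k` of SOME conductor-one Kolyvagin–Heegner datum on `(Dt, β, ι)`
(the tree's `KolyvaginHeegnerData.kolyvaginClass _ k`, i.e. the Kummer image of the basic Heegner point `y_K`).
[cite: GrossLMS1991, §3–§4] [cite: WZhang2014, §3.7 (3.21)] -/
def IsRealisation (d : DeepBipartiteData W K k) (Dt : ModularParametrizationData W N) (β : ℤ) (ι : K →+* ℂ) : Prop :=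
  ∃ dKH : KolyvaginHeegnerData Dt β ι 1, d.cls ∅ = dKH.kolyvaginClass Nat.prime_three k

/-- **SIGN**: `ε(m) = ±1` and complex conjugation `c` acts on `κ_k(m)` by `ε(m)` at every even deep level.
[cite: GrossLMS1991, Prop. 5.4 (2)] [cite: WZhang2014, §8.2] -/
def IsSignEigen (d : DeepBipartiteData W K k) (N : ℕ) (c : K ≃ₐ[ℚ] K) : Prop :=
  ∀ m : Finset ℕ, Even m.card → IsDeepLevel N W K k m →
    (d.sign m = 1 ∨ d.sign m = -1) ∧ conjAct W c ((3 ^ k : ℕ) : ℤ) (d.cls m) = d.sign m • d.cls m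

/-- **Selmer condition OFF the level, finite places**: at a finite place above no prime of `m`, `κ_k(m)` satisfies `E`'s own Kummer
condition (for the geometric classes: the local conditions of the congruent objects at the carriers agree with `E`'s for a DEEP congruence,
being functions of the torsion Galois module — part of what the SYSTEM stub asks). [cite: WZhang2014, §8.1 property (1), Thm. 5.2] -/
def SatisfiesKummerOff (d : DeepBipartiteData W K k) (N : ℕ) : Prop :=
  ∀ m : Finset ℕ, Even m.card → IsDeepLevel N W K k m →
    ∀ v : HeightOneSpectrum (𝓞 K), (∀ q ∈ m, ((q : ℕ) : 𝓞 K) ∉ v.asIdeal) →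
      d.cls m ∈ selmerLocalKer (W.baseChange K) (v.adicCompletion K) ((3 ^ k : ℕ) : ℤ)

/-- **Selmer condition at the infinite places.** [cite: WZhang2014, §8.1 property (1)] -/
def SatisfiesKummerInf (d : DeepBipartiteData W K k) (N : ℕ) : Prop :=
  ∀ m : Finset ℕ, Even m.card → IsDeepLevel N W K k m →
    ∀ w : InfinitePlace K, d.cls m ∈ selmerLocalKer (W.baseChange K) w.Completion ((3 ^ k : ℕ) : ℤ)

/-- **TORIC at the level primes**: above `q ∈ m` the localisation of `κ_k(m)` is represented by an augmentation-line-valued cocycle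
(Bertolini–Darmon's `H¹_ord`; the tree's `valuedLocalKer`, verbatim from the template at torsion level `3^k`).
[cite: BertoliniDarmon2005, §2.2–§2.3] [cite: WZhang2014, Thm. 5.2] -/
def SatisfiesToricOn (d : DeepBipartiteData W K k) (N : ℕ) : Prop :=
  ∀ m : Finset ℕ, Even m.card → IsDeepLevel N W K k m →
    ∀ q ∈ m, ∀ v : HeightOneSpectrum (𝓞 K), ((q : ℕ) : 𝓞 K) ∈ v.asIdeal →
      d.cls m ∈ (W.baseChange K).valuedLocalKer (v.adicCompletion K) ((3 ^ k : ℕ) : ℤ)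
        (AddSubgroup.closure {x | ∃ (g : Field.absoluteGaloisGroup (v.adicCompletion K))
          (y : AddSubgroup.torsionBy (localPoints (W.baseChange K) (v.adicCompletion K)) ((3 ^ k : ℕ) : ℤ)), x = g • y - y})

/-- **FIRST RECIPROCITY LAW in DEPTH currency** (Jochnowitz ∕ Bertolini–Darmon Thm. 4.2 shape at a deep Kolyvagin prime): for an even deep
level `m`, a deep `q ∉ m` and `s ≤ k`: `3^s ∣ λ_k(m ∪ q)` iff `loc_q κ_k(m)` is `3^s`-divisible in the FREE `ℤ/3^k`-module
`H¹(K_q, E[3^k])`, i.e. iff `3^{k−s}·κ_k(m)` is locally trivial above `q`. At `m = ∅`: `ord₃ λ_k({q}) = ord₃ loc_q(y_K)`.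
Printed for `3 ∤ N` (Bertolini–Darmon 1999 Thm. 1.3, admissible ∕ Kolyvagin `q`); at `9 ∥ N` nothing is printed (O5 `JochnowitzAtNine`,
mod-`3` census E-O5-JOCH3 30∕30 CONSISTENT). [cite: BertoliniDarmon1999, Thm. 1.3] [cite: BertoliniDarmon2005, Thm. 4.2] [cite: WZhang2014, Thm. 4.3] -/
def SatisfiesFirstLaw (d : DeepBipartiteData W K k) (N : ℕ) : Prop :=
  ∀ m : Finset ℕ, Even m.card → IsDeepLevel N W K k m → ∀ q : ℕ, q ∉ m → IsDeepKolyvaginPrime N W K k q →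
    ∀ s : ℕ, s ≤ k →
      (((3 ^ s : ℕ) : ZMod (3 ^ k)) ∣ d.val (insert q m) ↔
        ∀ v : HeightOneSpectrum (𝓞 K), ((q : ℕ) : 𝓞 K) ∈ v.asIdeal →
          ((3 : ℤ) ^ (k - s)) • d.cls m ∈ (W.baseChange K).torsionLocalKer (v.adicCompletion K) ((3 ^ k : ℕ) : ℤ))

/-- **SECOND RECIPROCITY LAW in DEPTH currency** (Bertolini–Darmon Thm. 4.1 shape): for an odd deep level `m′`, a deep `q ∉ m′` and `s ≤ k`:
`3^{k−s}·κ_k(m′ ∪ q)` is locally trivial above `q` (its toric coordinate is `3^s`-divisible) iff `3^s ∣ λ_k(m′)`.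
[cite: BertoliniDarmon2005, Thm. 4.1] [cite: WZhang2014, Thm. 4.3 (4.5)] -/
def SatisfiesSecondLaw (d : DeepBipartiteData W K k) (N : ℕ) : Prop :=
  ∀ m : Finset ℕ, Odd m.card → IsDeepLevel N W K k m → ∀ q : ℕ, q ∉ m → IsDeepKolyvaginPrime N W K k q →
    ∀ s : ℕ, s ≤ k →
      ((∀ v : HeightOneSpectrum (𝓞 K), ((q : ℕ) : 𝓞 K) ∈ v.asIdeal →
          ((3 : ℤ) ^ (k - s)) • d.cls (insert q m) ∈ (W.baseChange K).torsionLocalKer (v.adicCompletion K) ((3 ^ k : ℕ) : ℤ)) ↔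
        ((3 ^ s : ℕ) : ZMod (3 ^ k)) ∣ d.val m)

/-- **KATO DIVISIBILITY of the definite values (THE NEW LEVER, as a property)**: at every odd deep level `m′`, `3^{min(k,T)} ∣ λ_k(m′)`,
`T` the exponent handed in (meant: `T = ord₃ ∏_ℓ c_ℓ(E)`). For the geometric datum this is Kato's rank-zero Tamagawa-exact bound for the
raised newforms `g` and `g ⊗ χ_K` (Thm. 14.5 (3) + Poitou–Tate, (12.5.2) inherited from `E` for a deep congruence) through Gross's special-value
formula in the Ribet–Takahashi ∕ Pollack–Weston normalisation. [cite: Kato2004, Thm. 14.5 (3)] [cite: PollackWeston2011, Thm. 1.1, §6] [cite: RibetTakahashi1997, Thm. 1] -/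
def KatoDivisible (d : DeepBipartiteData W K k) (N T : ℕ) : Prop :=
  ∀ m : Finset ℕ, Odd m.card → IsDeepLevel N W K k m → ((3 ^ min k T : ℕ) : ZMod (3 ^ k)) ∣ d.val m

/-- The conjunction asked of the datum: a **divisible deep shadow system** of depth `k` on `(Dt, β, ι, c)` with Tamagawa exponent `T`. -/
def IsDivisibleShadowSystem (d : DeepBipartiteData W K k) (Dt : ModularParametrizationData W N) (β : ℤ) (ι : K →+* ℂ)
    (c : K ≃ₐ[ℚ] K) (T : ℕ) : Prop :=
  d.IsRealisation Dt β ι ∧ d.IsSignEigen N c ∧ d.SatisfiesKummerOff N ∧ d.SatisfiesKummerInf N ∧ d.SatisfiesToricOn N ∧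
    d.SatisfiesFirstLaw N ∧ d.SatisfiesSecondLaw N ∧ d.KatoDivisible N T

end DeepBipartiteData

/-! ## The statements of the six stubs (named), the FIRST RUNG, and the by-name plumbing -/

/-- **SYSTEM (RESEARCH XL; the statement of `stub_divisibleDeepBipartiteSystemAtThree`)**: on every leaf row in the habitat (`¬CM`, `Addv`,
`SubGss`, `HabDs`) with a lattice-optimal datum at its conductor `N` (`3 ∤ c`), every imaginary quadratic `K` with `d_K < −4` odd and Heegner
for `N` (so `3` splits), embedding `ι`, complex conjugation `c ≠ 1`, and every depth `k ≥ 1`, a deep bipartite datum mod `3^k` EXISTS which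
realises `y_K`, is sign-eigen, satisfies the Selmer conditions, both depth-currency reciprocity laws at deep Kolyvagin primes, AND whose odd
values are all divisible by `3^{min(k, ord₃ ∏ c_ℓ(E))}` — at every DEPTH `k > T := ord₃ ∏ c_ℓ(E)` (beyond the Tamagawa exponent every
carrier with `3 ∣ c_ℓ` is seen by `E[3^k]`, so the raised eigensystem is new at the carriers and keeps their component groups; at shallow depth an
`ℓ`-old raised form could lose a carrier and the divisibility would be BSD-false). NO rank hypothesis. Two joints inside: GEOMETRY (CM points on `X_{N;m}` and on the
definite Shimura sets at Kolyvagin primes with `9 ∣ N`, reciprocity on `τ`-eigenlines; printed only for admissible primes, `p ≥ 5`, `p ∤ N`: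
Bertolini–Darmon 2005 Thms. 4.1∕4.2, W. Zhang 2014 Thm. 4.3, Bertolini–Darmon 1999 Thm. 1.3 for `n = 1`) and KATO (rank-zero Tamagawa-exact
bounds for the raised newforms in the Gross ∕ Ribet–Takahashi normalisation; printed shape). Why it might fail: (i) at `9 ∥ N` the Brandt
∕ Jacobian side has mod-`3` multiplicity `μ ≥ 2` (O5 `MultiplicityAtNine`), so `λ_k` must be the ideal-membership functional of the ORIENTED
Gross vector and the transfer «`L_alg(g/K)` divisible for every congruent `g` ⟹ `λ_k` divisible» is proved here only in the free case; (ii) the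
`±`-eigenline replacement of admissibility must carry BOTH laws at every depth `s ≤ k`. [cite: BertoliniDarmon2005, Thm. 4.1, 4.2]
[cite: WZhang2014, Thm. 4.3, §8.1] [cite: BertoliniDarmon1999, Thm. 1.3, §5] [cite: Kato2004, Thm. 14.5 (3)] [cite: PollackWeston2011, §6] -/
def DivisibleDeepBipartiteSystemAtThree : Prop :=
  ∀ (W : WeierstrassCurve ℚ) [W.IsElliptic] [W.IsGloballyMinimal] (N : ℕ) [NeZero N]
    (K : Type) [Field K] [NumberField K]
    (Dt : ModularParametrizationData W N) (H : HeegnerDatum N (NumberField.discr K)) (ι : K →+* ℂ) (c : K ≃ₐ[ℚ] K),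
    ¬ W.HasCM → Addv W 3 → SubGss W 3 → W.conductorNorm ℤ = N → HabDs W →
    IsImaginaryQuadratic K → SatisfiesHeegnerHypothesis N K → Odd (NumberField.discr K) → NumberField.discr K < -4 → c ≠ 1 →
    (∀ z ∈ Dt.L.lattice, ∃ w ∈ periodLattice Dt.f, z = Dt.c * w) → ¬ (3 : ℤ) ∣ Dt.c →
    ∀ k : ℕ, padicValNat 3 W.tamagawaProduct < k →
      ∃ d : DeepBipartiteData W K k, d.IsDivisibleShadowSystem Dt H.β ι c (padicValNat 3 W.tamagawaProduct)

/-- **RIGIDITY (RESEARCH L; the statement of `stub_deepBipartiteRigidityAtThree`)**: Howard ∕ Bertolini–Darmon rigidity for deep bipartite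
systems at Kolyvagin primes, `p = 3`, with the Kato divisibility as input — if for EVERY depth `k > T = ord₃ ∏ c_ℓ(E)` a divisible deep shadow system exists
on the row and the basic Heegner point `P = y_K ∈ E(K)` is non-torsion, then
`ord₃ #Ш(E/K)[3^∞] + 2·ord₃ ∏ c_ℓ(E) ≤ 2·ord₃ [E(K) : ℤP]`. Intended proof: Howard 2006 Thm. 3.2.3 structure (`Sel_{3^k}(E/K) ≅ ℤ/3^k ⊕ M ⊕ M`,
`ind κ_k(∅) = e + length M`, `e` = the level-independent divisibility index of the system) with `e ≥ T` from `KatoDivisible` at a deep odd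
level where `M(m′) = 0`; `E(K)[3] = 0` and the Čebotarev supply from `HabDs`. Printed only for admissible primes and `p ≥ 5`; the `T = 0`
shadow is Kolyvagin–McCallum. Why it might fail: the eigenline bookkeeping of Howard's induction at Kolyvagin primes (two rank-one lines per
prime instead of one) may cost a factor at each step when `3 ∣ q+1` exactly to depth `k`. [cite: Howard2006, Thm. 3.2.3] [cite: BertoliniDarmon2005, §3]
[cite: McCallumLMS1991, Prop. 4.4, Thm. 5.8] [cite: GrossLMS1991, §6] -/
def DeepBipartiteRigidityAtThree : Prop :=
  ∀ (W : WeierstrassCurve ℚ) [W.IsElliptic] [W.IsGloballyMinimal] (N : ℕ) [NeZero N]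
    (K : Type) [Field K] [NumberField K]
    (Dt : ModularParametrizationData W N) (H : HeegnerDatum N (NumberField.discr K)) (ι : K →+* ℂ) (c : K ≃ₐ[ℚ] K)
    (P : (W.baseChange K).toAffine.Point),
    ¬ W.HasCM → Addv W 3 → SubGss W 3 → W.conductorNorm ℤ = N → HabDs W →
    IsImaginaryQuadratic K → SatisfiesHeegnerHypothesis N K → Odd (NumberField.discr K) → NumberField.discr K < -4 → c ≠ 1 →
    (∀ z ∈ Dt.L.lattice, ∃ w ∈ periodLattice Dt.f, z = Dt.c * w) → ¬ (3 : ℤ) ∣ Dt.c →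
    (WeierstrassCurve.Affine.Point.map ι.toRatAlgHom) P = heegnerPointComplex Dt H → ¬ IsOfFinAddOrder P →
    (∀ k : ℕ, padicValNat 3 W.tamagawaProduct < k →
      ∃ d : DeepBipartiteData W K k, d.IsDivisibleShadowSystem Dt H.β ι c (padicValNat 3 W.tamagawaProduct)) →
    padicValNat 3 (Nat.card (AddCommGroup.primaryComponent (W.baseChange K).sha 3)) + 2 * padicValNat 3 W.tamagawaProduct ≤
      2 * padicValNat 3 (AddSubgroup.zmultiples P).index

/-- **THE DISPLAY** (the common output of SYSTEM ∘ RIGIDITY, named so the kernel consumes it): on every habitat row with Heegner data as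
above and `y_K` non-torsion, `ord₃ #Ш(E/K)[3^∞] + 2·ord₃ ∏ c_ℓ(E) ≤ 2·ord₃ [E(K) : ℤ y_K]` — the `≤` half of the BSD-predicted EQUALITY for the
pair `(E, E^K)` (Gross–Zagier; `E(K)[3] = 0`, `3 ∤ c·u_K`). [cite: GrossZagier1986, Thm. I.(6.3), V.(2.2)] [cite: Jetchev2008, Conj. 1.3] -/
def DefiniteShadowDisplayAtThree : Prop :=
  ∀ (W : WeierstrassCurve ℚ) [W.IsElliptic] [W.IsGloballyMinimal] (N : ℕ) [NeZero N]
    (K : Type) [Field K] [NumberField K]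
    (Dt : ModularParametrizationData W N) (H : HeegnerDatum N (NumberField.discr K)) (ι : K →+* ℂ) (c : K ≃ₐ[ℚ] K)
    (P : (W.baseChange K).toAffine.Point),
    ¬ W.HasCM → Addv W 3 → SubGss W 3 → W.conductorNorm ℤ = N → HabDs W →
    IsImaginaryQuadratic K → SatisfiesHeegnerHypothesis N K → Odd (NumberField.discr K) → NumberField.discr K < -4 → c ≠ 1 →
    (∀ z ∈ Dt.L.lattice, ∃ w ∈ periodLattice Dt.f, z = Dt.c * w) → ¬ (3 : ℤ) ∣ Dt.c →
    (WeierstrassCurve.Affine.Point.map ι.toRatAlgHom) P = heegnerPointComplex Dt H → ¬ IsOfFinAddOrder P →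
    padicValNat 3 (Nat.card (AddCommGroup.primaryComponent (W.baseChange K).sha 3)) + 2 * padicValNat 3 W.tamagawaProduct ≤
      2 * padicValNat 3 (AddSubgroup.zmultiples P).index

/-- **SYSTEM ∘ RIGIDITY ⟹ DISPLAY** (logic only; sorry-free). -/
theorem definiteShadowDisplay_of_system_of_rigidity (hS : DivisibleDeepBipartiteSystemAtThree)
    (hR : DeepBipartiteRigidityAtThree) : DefiniteShadowDisplayAtThree :=
  fun W _ _ N _ K _ _ Dt H ι c P hCM hadd hsub hN hHab hK hHe hodd hdisc hc hopt hc3 hP hPt ↦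
    hR W N K Dt H ι c P hCM hadd hsub hN hHab hK hHe hodd hdisc hc hopt hc3 hP hPt
      (fun k hk ↦ hS W N K Dt H ι c hCM hadd hsub hN hHab hK hHe hodd hdisc hc hopt hc3 k hk)

/-- **THE FIRST RUNG `G₁` (the weakest unknown consequence of U₁ the line reaches first)**: on a habitat row, `ord₃ ∏ c_ℓ(E) ≤ ord₃ [E(K) : ℤ y_K]`
— the Tamagawa SUM divides the Heegner index (Jetchev's theorem gives the MAX; Gross–Zagier + BSD predict `index = T + ½·ord₃(Ш_an(E)·Ш_an(E^K))`;
CONSISTENT on the 33 residue rows of record, where `ord₃ Ш_an(E) = 0` and `m₀ = T + ½ ord₃ Ш_an(E^K)`). It DROPS OUT of the display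
(`ord₃ #Ш ≥ 0`): `firstRung_of_display` below, sorry-free. [cite: Jetchev2008, Thm. 1.1, Conj. 1.3] [cite: GrossZagier1986, V.(2.2)] -/
def HeegnerIndexTamagawaSumRungAtThree : Prop :=
  ∀ (W : WeierstrassCurve ℚ) [W.IsElliptic] [W.IsGloballyMinimal] (N : ℕ) [NeZero N]
    (K : Type) [Field K] [NumberField K]
    (Dt : ModularParametrizationData W N) (H : HeegnerDatum N (NumberField.discr K)) (ι : K →+* ℂ) (c : K ≃ₐ[ℚ] K)
    (P : (W.baseChange K).toAffine.Point),
    ¬ W.HasCM → Addv W 3 → SubGss W 3 → W.conductorNorm ℤ = N → HabDs W →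
    IsImaginaryQuadratic K → SatisfiesHeegnerHypothesis N K → Odd (NumberField.discr K) → NumberField.discr K < -4 → c ≠ 1 →
    (∀ z ∈ Dt.L.lattice, ∃ w ∈ periodLattice Dt.f, z = Dt.c * w) → ¬ (3 : ℤ) ∣ Dt.c →
    (WeierstrassCurve.Affine.Point.map ι.toRatAlgHom) P = heegnerPointComplex Dt H → ¬ IsOfFinAddOrder P →
    padicValNat 3 W.tamagawaProduct ≤ padicValNat 3 (AddSubgroup.zmultiples P).index

/-- `G₁` from the display (arithmetic: `a + 2T ≤ 2i ⟹ T ≤ i`). Sorry-free. -/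
theorem firstRung_of_display (hD : DefiniteShadowDisplayAtThree) : HeegnerIndexTamagawaSumRungAtThree :=
  fun W _ _ N _ K _ _ Dt H ι c P hCM hadd hsub hN hHab hK hHe hodd hdisc hc hopt hc3 hP hPt ↦ by
    have h := hD W N K Dt H ι c P hCM hadd hsub hN hHab hK hHe hodd hdisc hc hopt hc3 hP hPt
    omega

/-- **ROAD(`HabDs`)** — the habitat socket's `hHab` binder at `Hab := HabDs`, named (the conclusion of the kernel stub). -/
abbrev DefiniteShadowRoadAtThree : Prop :=
  ∀ (W : WeierstrassCurve ℚ) [W.IsElliptic] [W.IsGloballyMinimal] (N : ℕ) [NeZero N]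
    (Dt : ModularParametrizationData W N),
    ¬ W.HasCM → Addv W 3 → SubGss W 3 → W.analyticRank = 1 → W.conductorNorm ℤ = N →
    (∀ z ∈ Dt.L.lattice, ∃ w ∈ periodLattice Dt.f, z = Dt.c * w) → ¬ (3 : ℤ) ∣ Dt.c →
    HabDs W → MissingUpperBoundAt W 3

/-- **KERNEL (BOOKKEEPING M; the statement of `stub_definiteShadowKernelAtThree`)**: ROAD(`HabDs`) from the DISPLAY, the print of item 27491
(Gross–Zagier, Kolyvagin, modularity, Mazur, the leaf Manin input, a Heegner field `K` with `L(E^K,1) ≠ 0`, `d_K < −4` odd — Bump–Friedberg–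
Hoffstein ∕ Murty–Murty inside the item) and `L₀` = item 26023 for the LEAF partner `E^K` (`3` splits in `K`, so `E^K ≅ E` over `ℚ₃`): with
`r_an(E) = 1`, `L(E^K,1) ≠ 0`: `Ш(E/K)[3^∞] ⊇ Ш(E)[3^∞] ⊕ Ш(E^K)[3^∞]`, Gross–Zagier turns `2·ord₃[E(K):ℤy_K] − 2T` into
`ord₃ Ш_an(E) + ord₃ Ш_an(E^K)`, and `L₀(E^K)` removes the partner: `ord₃ #Ш(E)[3^∞] ≤ ord₃ Ш_an(E)` = `MissingUpperBoundAt W 3`. The v15 ∕ nscartan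
kernels (`RamifiedPairUpperBound…`, `upperHalfOverK…`) are the model; no mathematics beyond print bookkeeping. Why it might fail: only by a
mismatch of typed currencies (`LDerivEK`, `shaAn`, the item's field-supply clause) — bookkeeping. [cite: GrossZagier1986, Thm. I.(6.3)]
[cite: KolyvaginEuler1990, Thm. A] [cite: GrossLMS1991, §6] -/
def DefiniteShadowKernelAtThreeStatement : Prop :=
  DefiniteShadowDisplayAtThree → LeafRankOnePrintedInputsAtThree → Gss2LowerAtThreeRankZero → DefiniteShadowRoadAtThree

/-- **Σ★⁸|¬HabDs (RESIDUE; the statement of `stub_leafSigmaStarTopLayerOffDefiniteHabitat`)**: v15's registered Σ★⁸ signature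
(`SplitKolyvagin.stub_leafSigmaStarTopLayerDivisibilityAtThreeOptimalOffSavingRows`) with the ONE new hypothesis `¬ HabDs W` inserted before
`IsImaginaryQuadratic K` — literally the habitat socket's `hStar` binder at `Hab := HabDs` (the same text as nscartan's Σ★⁸|¬HabNs with the
habitat swapped). Item 27493 ⟹ it by name (`LeafShimuraInert.sigmaStarTopLayerOffHabitat_of_leafSigmaStarOptOffRows HabDs`). What it still
ASKS: top-layer `3`-divisibility of derived Heegner points on leaf residue rows whose `3`-adic image does NOT contain `SL₂(ℤ₃)` (`ρ̄₃` is onto on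
all 33 residue classes of record; the known finite support is the sub-family with Elkies' mod-`9` defect, if any, plus rows beyond the table).
[cite: Jetchev2008, Conj. 1.3, Thm. 1.4 (ii)] [cite: Zhang2014CJM, Thm. 1.1] -/
abbrev SigmaStarTopLayerOffDefiniteHabitat : Prop :=
  ∀ (W : WeierstrassCurve ℚ) [W.IsElliptic] [W.IsGloballyMinimal] (N : ℕ) [NeZero N]
    (K : Type) [Field K] [NumberField K]
    (Dt : ModularParametrizationData W N) (H : HeegnerDatum N (NumberField.discr K)) (ι : K →+* ℂ)
    (P : (W.baseChange K).toAffine.Point),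
    ¬ W.HasCM → Addv W 3 → SubGss W 3 → W.conductorNorm ℤ = N →
    (∀ z ∈ Dt.L.lattice, ∃ w ∈ periodLattice Dt.f, z = Dt.c * w) →
    ¬ (∃ (q : ℕ) (_ : Fact q.Prime), q ∣ N ∧
        padicValNat 3 W.tamagawaProduct ≤ padicValNat 3 ((W.baseChange ℚ_[q]).localTamagawaNumber ℤ_[q])) →
    ¬ ((∀ (q : ℕ) [Fact q.Prime], 3 ∣ (W.baseChange ℚ_[q]).localTamagawaNumber ℤ_[q] →
          W.HasSplitMultiplicativeReductionAtPrime q) ∧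
        ∃ S : Finset ℕ, Even S.card ∧ (∀ ℓ ∈ S, ∃ _ : Fact ℓ.Prime, W.HasMultiplicativeReductionAtPrime ℓ) ∧
          (∀ (ℓ : ℕ) [Fact ℓ.Prime], ℓ ∉ S → W.HasSplitMultiplicativeReductionAtPrime ℓ →
            ¬ 3 ∣ padicValInt ℓ W.minimalDiscriminantInt) ∧
          ((∃ ℓ₀ ∈ S, ¬ 3 ∣ padicValInt ℓ₀ W.minimalDiscriminantInt) ∨
            (∃ ℓ₀ t : ℕ, ∃ _ : Fact ℓ₀.Prime, ∃ _ : Fact t.Prime,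
              W.HasMultiplicativeReductionAtPrime ℓ₀ ∧ W.HasMultiplicativeReductionAtPrime t ∧
              ℓ₀ ∉ S ∧ t ∉ S ∧ t ≠ ℓ₀ ∧ ¬ 3 ∣ padicValInt ℓ₀ W.minimalDiscriminantInt) ∨
            (∃ R : Finset ℕ, R ⊆ S ∧ 2 * R.card = S.card ∧ ∀ q ∈ R, q = 2 ∨ ¬ 3 ∣ q - 1))) →
    ¬ (Surj W 3 ∧ ∃ (q₁ : ℕ) (_ : Fact q₁.Prime), ¬ W.HasGoodReductionAtPrime q₁ ∧
        (∀ (q : ℕ) [Fact q.Prime], q ≠ q₁ → 3 ∣ (W.baseChange ℚ_[q]).localTamagawaNumber ℤ_[q] →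
          W.HasSplitMultiplicativeReductionAtPrime q) ∧
        ∃ S : Finset ℕ, Even S.card ∧ q₁ ∉ S ∧
          (∀ ℓ ∈ S, ∃ _ : Fact ℓ.Prime, W.HasMultiplicativeReductionAtPrime ℓ) ∧
          (∀ (ℓ : ℕ) [Fact ℓ.Prime], ℓ ∉ S → ℓ ≠ q₁ → W.HasSplitMultiplicativeReductionAtPrime ℓ →
            ¬ 3 ∣ padicValInt ℓ W.minimalDiscriminantInt) ∧
          ((∃ ℓ₀ ∈ S, ¬ 3 ∣ padicValInt ℓ₀ W.minimalDiscriminantInt) ∨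
            (∃ ℓ₀ t : ℕ, ∃ _ : Fact ℓ₀.Prime, ∃ _ : Fact t.Prime,
              W.HasMultiplicativeReductionAtPrime ℓ₀ ∧ W.HasMultiplicativeReductionAtPrime t ∧
              ℓ₀ ∉ S ∧ t ∉ S ∧ t ≠ ℓ₀ ∧ ¬ 3 ∣ padicValInt ℓ₀ W.minimalDiscriminantInt) ∨
            (∃ R : Finset ℕ, R ⊆ S ∧ 2 * R.card = S.card ∧ ∀ q ∈ R, q = 2 ∨ ¬ 3 ∣ q - 1))) →
    ¬ HabDs W →
    IsImaginaryQuadratic K → SatisfiesHeegnerHypothesis N K →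
    (WeierstrassCurve.Affine.Point.map ι.toRatAlgHom) P = heegnerPointComplex Dt H →
    ¬ IsOfFinAddOrder P → Odd (NumberField.discr K) →
    ∀ (s' : ℕ), s' ≤ padicValNat 3 W.tamagawaProduct + padicValNat 3 Dt.c.natAbs →
    ∀ (n : ℕ) (d : KolyvaginHeegnerData Dt H.β ι n), Squarefree n →
    (∀ ℓ ∈ n.primeFactors, Zhang2014.IsKolyvaginPrime N W K 3 ℓ ∧ s' ≤ Zhang2014.kolyvaginIndex W 3 ℓ) →
    (∀ (q : ℕ) [Fact q.Prime], q ∣ N → padicValNat 3 ((W.baseChange ℚ_[q]).localTamagawaNumber ℤ_[q]) < s') →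
    Koly.PDiv d 3 s'

/-- **PRINT (the statement of `stub_printFacts`)**: item 27491 `LeafRankOnePrintedInputsAtThree` and the six cite-only named facts the habitat
socket consumes for its Σ★-side (Gross 1991 Prop. 3.7 (2) and §6 image-free; Jacquet–Langlands parametrisations; Pasten's component orders;
Friedberg–Hoffstein with prescribed splitting; split-reduced Shimura CM-point primitives), BY NAME. PRINT, never progress.
[cite: GrossZagier1986, Thm. I.(6.3)] [cite: GrossLMS1991, Prop. 3.7 (2), §6] [cite: FriedbergHoffstein1995, Thm. B] [cite: PastenShimura2024, Prop. 6.13] -/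
def PrintFacts : Prop :=
  LeafRankOnePrintedInputsAtThree ∧ GrossLMS1991.prop37_2_frobeniusCongruence ∧ Gross1991_heegnerPoint_sub_ratTorsion_mem_E0_imageFree ∧
    nonempty_shimuraParametrizationData ∧ PastenShimura2024_componentOrders ∧ friedbergHoffstein_exists_twist_ne_zero_inertAt_splitAt ∧
    shimuraCurve_heegnerSystem_primitivesSplitReduced

/-! ## The stubs -/

/-- STUB PRINT — item 27491 and the socket's six named facts, by name. -/
theorem stub_printFacts : PrintFacts := by
  sorry

/-- STUB SYSTEM — RESEARCH XL, THE NEW LEVER (Kato on the level-raised definite forms + the deep bipartite geometry at Kolyvagin primes, `9 ∣ N`). -/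
theorem stub_divisibleDeepBipartiteSystemAtThree : DivisibleDeepBipartiteSystemAtThree := by
  sorry

/-- STUB RIGIDITY — RESEARCH L (Howard ∕ Bertolini–Darmon rigidity at Kolyvagin primes, `p = 3`, with the Kato divisibility as input). -/
theorem stub_deepBipartiteRigidityAtThree : DeepBipartiteRigidityAtThree := by
  sorry

/-- STUB KERNEL — BOOKKEEPING M (display + item 27491 + item 26023 ⟹ ROAD(`HabDs`)). -/
theorem stub_definiteShadowKernelAtThree : DefiniteShadowKernelAtThreeStatement := by
  sorry

/-- STUB Σ★⁸|¬HabDs — RESIDUE on the non-`SL₂` rows (item 27493 ⟹ it by name). -/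
theorem stub_leafSigmaStarTopLayerOffDefiniteHabitat : SigmaStarTopLayerOffDefiniteHabitat := by
  sorry

/-- STUB L₀ — item stmt-BirchSwinnertonDyer-26023 `Gss2LowerAtThreeRankZero` BY NAME (also a binder of the route's `closes`). [cite: Miller2011LMS, Def. 1.1] -/
theorem stub_gss2LowerAtThreeRankZero : Gss2LowerAtThreeRankZero := by
  sorry

/-! ### Name-keyed aliases of the stub statements (tree pattern of line `katoprhalf`): `Registered.stub_X` is `X`'s statement under the
registered stub's short name, so the native skeleton audit reads the composition's hypotheses as the registered stubs. -/
namespace Registered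

/-- alias: statement of `stub_printFacts`. -/
abbrev stub_printFacts : Prop := PrintFacts
/-- alias: statement of `stub_divisibleDeepBipartiteSystemAtThree`. -/
abbrev stub_divisibleDeepBipartiteSystemAtThree : Prop := DivisibleDeepBipartiteSystemAtThree
/-- alias: statement of `stub_deepBipartiteRigidityAtThree`. -/
abbrev stub_deepBipartiteRigidityAtThree : Prop := DeepBipartiteRigidityAtThree
/-- alias: statement of `stub_definiteShadowKernelAtThree`. -/
abbrev stub_definiteShadowKernelAtThree : Prop := DefiniteShadowKernelAtThreeStatement
/-- alias: statement of `stub_leafSigmaStarTopLayerOffDefiniteHabitat`. -/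
abbrev stub_leafSigmaStarTopLayerOffDefiniteHabitat : Prop := SigmaStarTopLayerOffDefiniteHabitat
/-- alias: statement of `stub_gss2LowerAtThreeRankZero`. -/
abbrev stub_gss2LowerAtThreeRankZero : Prop := Gss2LowerAtThreeRankZero

end Registered

/-- consistency: each stub proves its name-keyed alias (definitional). -/
example : Registered.stub_printFacts ∧ Registered.stub_divisibleDeepBipartiteSystemAtThree ∧
    Registered.stub_deepBipartiteRigidityAtThree ∧ Registered.stub_definiteShadowKernelAtThree ∧
    Registered.stub_leafSigmaStarTopLayerOffDefiniteHabitat ∧ Registered.stub_gss2LowerAtThreeRankZero :=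
  ⟨stub_printFacts, stub_divisibleDeepBipartiteSystemAtThree, stub_deepBipartiteRigidityAtThree,
    stub_definiteShadowKernelAtThree, stub_leafSigmaStarTopLayerOffDefiniteHabitat, stub_gss2LowerAtThreeRankZero⟩

/-! ## The composition -/

/-- **The crux from the six registered stub statements, BY NAME** (kernel-checked): PRINT → SYSTEM → RIGIDITY → KERNEL → Σ★⁸|¬HabDs → L₀ →
`LeafRankOneUpperAtThree`, through the habitat socket §1 at `Hab := HabDs`, its ROAD binder fed by the kernel on the display
`definiteShadowDisplay_of_system_of_rigidity`. CONDITIONAL on every stub; U₁ stays OPEN; BSD is not proved.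
[cite: Kato2004, Thm. 14.5 (3)] [cite: Howard2006, Thm. 3.2.3] [cite: BertoliniDarmon2005, Thm. 4.1, 4.2] [cite: Jetchev2008, Conj. 1.3] -/
theorem LeafRankOneUpperAtThree_of (h₁ : Registered.stub_printFacts)
    (h₂ : Registered.stub_divisibleDeepBipartiteSystemAtThree) (h₃ : Registered.stub_deepBipartiteRigidityAtThree)
    (h₄ : Registered.stub_definiteShadowKernelAtThree) (h₅ : Registered.stub_leafSigmaStarTopLayerOffDefiniteHabitat)
    (h₆ : Registered.stub_gss2LowerAtThreeRankZero) :
    Summit.BirchSwinnertonDyer.BirchSwinnertonDyer.Theses.RamifiedHeegnerPair.LeafRankOneUpperAtThree := by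
  obtain ⟨hpub, h37, hF1, hJL, hCO, hFH2, hPrimS⟩ := h₁
  exact LeafShimuraInert.leafRankOneUpperAtThree_of_habitatRoad_of_sigmaStarTopLayerOffHabitat_of_lowerRankZero HabDs hpub h37 hF1
    hJL hCO hFH2 hPrimS (h₄ (definiteShadowDisplay_of_system_of_rigidity h₂ h₃) hpub h₆) h₅ h₆

/-- The crux from the registered stubs. -/
theorem LeafRankOneUpperAtThree_of_stubs :
    Summit.BirchSwinnertonDyer.BirchSwinnertonDyer.Theses.RamifiedHeegnerPair.LeafRankOneUpperAtThree :=
  LeafRankOneUpperAtThree_of stub_printFacts stub_divisibleDeepBipartiteSystemAtThree stub_deepBipartiteRigidityAtThree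
    stub_definiteShadowKernelAtThree stub_leafSigmaStarTopLayerOffDefiniteHabitat stub_gss2LowerAtThreeRankZero

end Summit.BirchSwinnertonDyer.BirchSwinnertonDyer.Cruxes.LeafRankOneUpperAtThree.Definitesum

end
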